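import Literature.NumberTheory.EllipticCurves.SelmerGaloisActionPlaces
import Literature.NumberTheory.GaloisCohomology.KolyvaginSystems
import HarnessLib

/-!
# T1 JET (cell `bsd-jet`), road K, stub S1/S2 interface: `σ_*`-stability is preserved by the
# Mazur–Rubin modifications `𝓕^a_b(c)` of Selmer structures on `E[n]`

HONEST FRAMING (programme file `BSD-LIT2PART-PROGRAMME-v1.md` §HONESTY, verbatim): «no tranche here
proves BSD; ARM L moves the LITERAL column of an r ≤ 1 census into the kernel-proved-modulo-named-print
column; ARM P changes what «named print» is worth.» THEOREMS ONLY (seat `bsd-jet-pv-1`, session g4;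
`--supports stmt-BirchSwinnertonDyer-14418`, helper): no definition, no named fact, no `sorry`.
Nothing is booked; 0 classes move.

## What

The signed counting theorems (`Rank1ResidualJetSignedGlobalDuality[Plus].lean`) ask that the Selmer
structures `𝓕 ≤ 𝓖` on `E[n]` be carried into themselves by `σ_*` (`conjActPlace`) at the finite
places. Jetchev's structures `𝓕(c)`, `𝓕_⌈q⌉(c)`, `(𝓕₀)^ℓ(c)`, `(𝓕₀)_ℓ(c)` (stub S2; pv-2's
`Jetchev2008.selmerF/selmerF0`) are Mazur–Rubin MODIFICATIONS (`SelmerStructure.modify`, relaxed at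
`a`, strict at `b`, a second family `𝒯` at `c`) of the Kummer structure (which is `σ_*`-stable:
`conjActPlace_mem_kummerSelmerStructure`). This file proves the bookkeeping step:

* `conjActPlace_mem_modify` — if `𝓕` and `𝒯` are carried into themselves by `σ_*` and the place
  sets `a`, `b`, `c` are `σ`-stable, then so is `𝓕.modify 𝒯 a b c`;
* `conjActPlace_mem_kummerSelmerStructure_modify` — the case `𝓕 = ` Kummer structure.

References (locators only; no cited FACT is declared): [cite: Jetchev2008, §4.3 (p. 820–821), Def. 4.8]
[cite: MazurRubin2004, Def. 2.1.1, Example 2.1.8] [cite: Sakamoto2024, Def. 3.3 (p. 922)].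
Design: no definitions; universe `u` for `K`. Axioms: `propext`, `Classical.choice`, `Quot.sound`.
-/

set_option autoImplicit false

noncomputable section

open scoped Classical
open NumberField IsDedekindDomain WeierstrassCurve
open Literature.NumberTheory.EllipticCurves Literature.NumberTheory.GaloisRepresentations
open Literature.NumberTheory.GaloisCohomology
open Literature.NumberTheory.GaloisRepresentations.DiscreteGaloisModule (SelmerStructure)

universe u

namespace Summit.BirchSwinnertonDyer.Rank1Residual.JET.GlobalDuality

section Modify

variable {K : Type u} [Field K] [NumberField K] (W : WeierstrassCurve ℚ) (σ : K ≃ₐ[ℚ] K) (n : ℤ)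

/-- **`σ_*`-stability is preserved by the Mazur–Rubin modification `𝓕^a_b(c)`**: if `σ_*`
(`conjActPlace`) carries `𝓕_v` into `𝓕_{σv}` and `𝒯_v` into `𝒯_{σv}` at all finite places, and the
sets `a` (relaxed), `b` (strict), `c` (modified to `𝒯`) of finite places are `σ`-stable, then `σ_*`
carries `(𝓕.modify 𝒯 a b c)_v` into `(𝓕.modify 𝒯 a b c)_{σv}` (case by case on the four clauses of
`SelmerStructure.modify`). For Jetchev's `𝓕(c) = Kum.transverseAt 𝒯 (c)` and
`𝓕_⌈q⌉(c) = 𝓕(c).modify 𝒮 ∅ ∅ (q)` with `σ`-stable `(c)`, `(q)` (inert Kolyvagin primes; both places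
over a split `q`). [cite: Jetchev2008, §4.3 (pp. 820–821), Def. 4.8] [cite: MazurRubin2004, Example 2.1.8] -/
theorem conjActPlace_mem_modify (𝓕 𝒯 : SelmerStructure ((W.baseChange K).torsionGaloisModule n))
    (a b c : Finset (HeightOneSpectrum (𝓞 K)))
    (h𝓕 : ∀ (v w : HeightOneSpectrum (𝓞 K)) (h : σ • v = w)
      (x : galoisCohomology (((W.baseChange K).torsionGaloisModule n).toLocal (Sum.inr v : Place K)) 1),
      x ∈ 𝓕 (Sum.inr v) → conjActPlace W σ n h x ∈ 𝓕 (Sum.inr w))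
    (h𝒯 : ∀ (v w : HeightOneSpectrum (𝓞 K)) (h : σ • v = w)
      (x : galoisCohomology (((W.baseChange K).torsionGaloisModule n).toLocal (Sum.inr v : Place K)) 1),
      x ∈ 𝒯 (Sum.inr v) → conjActPlace W σ n h x ∈ 𝒯 (Sum.inr w))
    (ha : ∀ v : HeightOneSpectrum (𝓞 K), σ • v ∈ a ↔ v ∈ a)
    (hb : ∀ v : HeightOneSpectrum (𝓞 K), σ • v ∈ b ↔ v ∈ b)
    (hc : ∀ v : HeightOneSpectrum (𝓞 K), σ • v ∈ c ↔ v ∈ c)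
    {v w : HeightOneSpectrum (𝓞 K)} (h : σ • v = w)
    {x : galoisCohomology (((W.baseChange K).torsionGaloisModule n).toLocal (Sum.inr v : Place K)) 1}
    (hx : x ∈ 𝓕.modify 𝒯 a b c (Sum.inr v)) :
    conjActPlace W σ n h x ∈ 𝓕.modify 𝒯 a b c (Sum.inr w) := by
  have haw : w ∈ a ↔ v ∈ a := by rw [← h]; exact ha v
  have hbw : w ∈ b ↔ v ∈ b := by rw [← h]; exact hb v
  have hcw : w ∈ c ↔ v ∈ c := by rw [← h]; exact hc v
  by_cases hva : v ∈ a
  · rw [SelmerStructure.modify_inr_of_mem_relaxed _ _ (haw.mpr hva)]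
    trivial
  by_cases hvb : v ∈ b
  · rw [SelmerStructure.modify_inr_of_mem_strict _ _ hva hvb] at hx
    rw [SelmerStructure.modify_inr_of_mem_strict _ _ (fun hw => hva (haw.mp hw)) (hbw.mpr hvb),
      (AddSubgroup.mem_bot.mp hx), map_zero]
    exact zero_mem _
  by_cases hvc : v ∈ c
  · rw [SelmerStructure.modify_inr_of_mem_transverse _ _ hva hvb hvc] at hx
    rw [SelmerStructure.modify_inr_of_mem_transverse _ _ (fun hw => hva (haw.mp hw))
      (fun hw => hvb (hbw.mp hw)) (hcw.mpr hvc)]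
    exact h𝒯 _ _ h x hx
  · rw [SelmerStructure.modify_inr_of_not_mem _ _ hva hvb hvc] at hx
    rw [SelmerStructure.modify_inr_of_not_mem _ _ (fun hw => hva (haw.mp hw))
      (fun hw => hvb (hbw.mp hw)) (fun hw => hvc (hcw.mp hw))]
    exact h𝓕 _ _ h x hx

/-- **The modifications of the Kummer structure on `E[n]` are `σ_*`-stable** (for `σ`-stable place
sets and a `σ_*`-stable second family `𝒯`): the case `𝓕 = kummerSelmerStructure` of
`conjActPlace_mem_modify`, by `conjActPlace_mem_kummerSelmerStructure`. This is the hypothesis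
`h𝓕σ`/`h𝓖σ` of the signed counting theorems for Jetchev's `𝓕(c) = Kum^∅_∅(c)`.
[cite: Jetchev2008, §4.3 (pp. 820–821)] [cite: MazurRubin2004, Example 2.1.8] -/
theorem conjActPlace_mem_kummerSelmerStructure_modify
    (𝒯 : SelmerStructure ((W.baseChange K).torsionGaloisModule n))
    (a b c : Finset (HeightOneSpectrum (𝓞 K)))
    (h𝒯 : ∀ (v w : HeightOneSpectrum (𝓞 K)) (h : σ • v = w)
      (x : galoisCohomology (((W.baseChange K).torsionGaloisModule n).toLocal (Sum.inr v : Place K)) 1),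
      x ∈ 𝒯 (Sum.inr v) → conjActPlace W σ n h x ∈ 𝒯 (Sum.inr w))
    (ha : ∀ v : HeightOneSpectrum (𝓞 K), σ • v ∈ a ↔ v ∈ a)
    (hb : ∀ v : HeightOneSpectrum (𝓞 K), σ • v ∈ b ↔ v ∈ b)
    (hc : ∀ v : HeightOneSpectrum (𝓞 K), σ • v ∈ c ↔ v ∈ c)
    {v w : HeightOneSpectrum (𝓞 K)} (h : σ • v = w)
    {x : galoisCohomology (((W.baseChange K).torsionGaloisModule n).toLocal (Sum.inr v : Place K)) 1}
    (hx : x ∈ ((W.baseChange K).kummerSelmerStructure n).modify 𝒯 a b c (Sum.inr v)) :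
    conjActPlace W σ n h x ∈ ((W.baseChange K).kummerSelmerStructure n).modify 𝒯 a b c (Sum.inr w) :=
  conjActPlace_mem_modify W σ n _ 𝒯 a b c
    (fun _ _ h' _ hx' => conjActPlace_mem_kummerSelmerStructure W σ n h' hx') h𝒯 ha hb hc h hx

end Modify

end Summit.BirchSwinnertonDyer.Rank1Residual.JET.GlobalDuality

end
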